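import Summits.BirchSwinnertonDyer.BirchSwinnertonDyer.Theorems.Rank1ResidualJetSection6Bridge
import HarnessLib

/-!
# T1 JET (cell `bsd-jet`), road K: the bridge in MINIMAL form — Prop. 6.4 and Thm. 6.3 are needed
# only at levels `k ≥ 1` and at conductors of depth `m(c) = m_∞`

HONEST FRAMING (programme file §HONESTY, verbatim): «no tranche here proves BSD; ARM L moves the
LITERAL column of an r ≤ 1 census into the kernel-proved-modulo-named-print column.» THEOREMS ONLY
(seat `bsd-jet-pv-2`, session g2; `--supports stmt-BirchSwinnertonDyer-14418`, helper); 0 classes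
move. WHY: the bridge `JET.derivedPoint_divisible_of_prop52_of_section6` (p482829) asks its hypothesis
`H` for [J] Prop. 6.4 at EVERY level `k` and EVERY conductor `c` with `m(c) + k ≤ M(c)`, and for
Thm. 6.3 at every `k`; the printed proof of Thm. 1.4 (p. 825) uses them once, at
`k = max(t, m_∞) + 1 ≥ 1` and at a conductor with `m(c) = m_∞ < ∞`. The typed Prop. 5.3
(`Jetchev2008.prop53_exists_coreVertex_of_depth_add_le_levelIndex`, p485508; and its `p ∣ N` reading
`JET.JetchevCoreVertexExistence`) is stated for `1 ≤ m` and a derived point of FINITE exact depth, so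
it can only feed the minimal form. This file re-proves the abstract step and the bridge with the
minimal hypotheses (proofs verbatim otherwise):

* `Section6.tamagawaExponent_le_mInfty_of_coreVertices_min` — [J] proof of Thm. 1.4, abstract, with
  `h64`/`h63` restricted to `1 ≤ k` and `m c = m_∞`.
* `derivedPoint_divisible_of_prop52_of_section6_min` — the bridge with the correspondingly weaker
  `H`; `…CarrierMult/Ne/Add_of_prop52_of_section6_min` — K3 ∕ K1 ∕ K4 from McCallum Prop. 5.2 + the
  weaker `H`.

References: [cite: Jetchev2008, Proof of Thm. 1.1 (p. 824) = arXiv Proof of Thm. 1.4 (p0017 L5–L20); Prop. 5.3, Thm. 5.2]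
[cite: McCallumLMS1991, §5 Prop. 5.2 (p. 304)].
-/

set_option autoImplicit false

noncomputable section

open scoped Classical

open WeierstrassCurve Literature.NumberTheory.EllipticCurves
  Literature.NumberTheory.EllipticCurves.ModularForms

namespace Summit.BirchSwinnertonDyer.Rank1Residual.JET

/-- **[J] proof of Thm. 1.4, abstract, MINIMAL hypotheses**: as
`Section6.tamagawaExponent_le_mInfty_of_coreVertices` (p471669) but Prop. 6.4 (`h64`) is required only
at levels `k ≥ 1` and conductors with `m(c) = m_∞`, and Thm. 6.3 (`h63`) only at `k ≥ 1`. Same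
printed proof: `k := max(t, m_∞) + 1`, `hK` gives `c` with `m(c) = m_∞`, `M(c) ≥ k + m_∞`; `h64`;
`h63`. [cite: Jetchev2008, Proof of Thm. 1.1 (p. 824); Prop. 5.3 (p. 823); Thm. 5.2 (p. 821)] -/
theorem Section6.tamagawaExponent_le_mInfty_of_coreVertices_min
    {Λ : Type*} (M m : Λ → ℕ∞) (Core : ℕ → Λ → Prop) (t mInf : ℕ)
    (hmInf : ∀ c, (mInf : ℕ∞) ≤ m c)
    (hK : ∀ m' : ℕ, ∃ c, (m' : ℕ∞) ≤ M c ∧ m c = mInf)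
    (h64 : ∀ (k : ℕ) (c : Λ), 1 ≤ k → m c = mInf → (mInf : ℕ∞) + k ≤ M c →
      ∃ c', Core k c' ∧ (k : ℕ∞) + mInf ≤ M c' ∧ m c' ≤ mInf)
    (h63 : ∀ (k : ℕ) (c : Λ), 1 ≤ k → Core k c → m c = mInf → (k : ℕ∞) + mInf ≤ M c →
      t < k → mInf < k → t ≤ mInf) :
    t ≤ mInf := by
  set k : ℕ := max t mInf + 1 with hk
  have hk1 : 1 ≤ k := by omega
  have htk : t < k := by omega
  have hInfk : mInf < k := by omega
  obtain ⟨c, hMc, hmc⟩ := hK (k + mInf)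
  have hck : (mInf : ℕ∞) + k ≤ M c := by
    calc (mInf : ℕ∞) + k = ((k + mInf : ℕ) : ℕ∞) := by push_cast; ring
      _ ≤ M c := hMc
  obtain ⟨c', hcore, hMc', hmc'⟩ := h64 k c hk1 hmc hck
  exact h63 k c' hk1 hcore (le_antisymm hmc' (hmInf c')) hMc' htk hInfk

/-- **The bridge, minimal form** (same statement and proof as `derivedPoint_divisible_of_prop52_of_section6`, but the hypothesis `H` asks for Prop. 6.4 / Thm. 6.3 ONLY at levels `k ≥ 1` and at conductors with `m(c) = m_∞` — the only instances the printed proof of Thm. 1.4 uses — which is the shape the typed Prop. 5.3 (`Jetchev2008.prop53_…`, `1 ≤ m`, `P_c` of finite exact depth) can feed). For `W/ℚ` (globally minimal, non-CM), `K` Heegner with `d_K ∉ {−3,−4}`, `p ≠ 2` with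
the `p`-adic tower, a frame `(Dt, β, ι)` with `y_K = d₁.derivedPoint` of infinite order, and a number
`t`: IF [J] Prop. 6.4 and Thm. 6.3 hold for the row objects — hypothesis `H`, quantified over every
depth function `mdiv` with `(u : ℕ∞) ≤ mdiv c ↔` «every derived point of conductor `c` is
`p^u`-divisible», `m c = mdiv c` if `mdiv c < M(c) := Zhang2014.levelIndex` else `⊤`, and every `mInf`
satisfying `mInf ≤ m c` and Kolyvagin's redefinition (these two are PROVED below from McCallum 1991
Prop. 5.2, `h52`) — THEN every derived point `P_n` with `n` a square-free product of Kolyvagin primes of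
index `≥ s`, `s ≤ t`, is `p^s`-divisible in `E(K[n])`. Proof: if `s ≤ m'(n)` done; else `m'(n) < M(n)`
so McCallum's set `⋃_r M_r`-candidates is non-empty, `m_∞ :=` its minimum, `hmInf` by minimality, `hK`
by `c = 1` (`r = 0`) or by Prop. 5.2 via `McCallum1991.exists_conductor_levelIndex_ge_exactDepth_of_prop52`
(`r ≥ 1`), then `Section6.depth_le_mdiv_of_coreVertices`.
[cite: Jetchev2008, Proof of Thm. 1.4 (p. 825), §3.1 item 5 (p. 817)] [cite: McCallumLMS1991, §5 Prop. 5.2 (p. 304)] -/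
theorem derivedPoint_divisible_of_prop52_of_section6_min
    (h52 : McCallum1991.prop52_exists_conductor_kolyvaginClass_order_eq)
    (W : WeierstrassCurve ℚ) [W.IsElliptic] [W.IsGloballyMinimal] [NeZero (W.conductorNorm ℤ)]
    (hcm : ¬ W.HasCM) (K : Type) [Field K] [NumberField K] (hK : IsImaginaryQuadratic K)
    (hD3 : NumberField.discr K ≠ -3) (hD4 : NumberField.discr K ≠ -4)
    (hH : SatisfiesHeegnerHypothesis (W.conductorNorm ℤ) K)
    (p : ℕ) [Fact p.Prime] (hp2 : p ≠ 2) (htower : ∀ n : ℕ, W.HasSurjectiveModNGaloisRep (p ^ n : ℕ))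
    (Dt : ModularParametrizationData W (W.conductorNorm ℤ)) (β : ℤ) (ι : K →+* ℂ)
    (d₁ : KolyvaginHeegnerData Dt β ι 1) (hy : ¬ IsOfFinAddOrder d₁.derivedPoint) (t : ℕ)
    (H : ∀ (mdiv m : {c : ℕ // Squarefree c ∧ ∀ ℓ ∈ c.primeFactors,
          Zhang2014.IsKolyvaginPrime (W.conductorNorm ℤ) W K p ℓ} → ℕ∞),
      (∀ c (u : ℕ), (u : ℕ∞) ≤ mdiv c ↔ ∀ d : KolyvaginHeegnerData Dt β ι c.1,
        ∃ Q : (W.baseChange (ringClassField K ι c.1)).toAffine.Point,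
          ((p ^ u : ℕ) : ℤ) • Q = d.derivedPoint) →
      (∀ c, m c = if mdiv c < Zhang2014.levelIndex W p c.1 then mdiv c else ⊤) →
      ∀ mInf : ℕ, (∀ c, (mInf : ℕ∞) ≤ m c) →
        (∀ m' : ℕ, ∃ c, (m' : ℕ∞) ≤ Zhang2014.levelIndex W p c.1 ∧ m c = mInf) →
      ∃ Core : ℕ → {c : ℕ // Squarefree c ∧ ∀ ℓ ∈ c.primeFactors,
          Zhang2014.IsKolyvaginPrime (W.conductorNorm ℤ) W K p ℓ} → Prop,
        (∀ (k : ℕ) c, 1 ≤ k → m c = mInf → (mInf : ℕ∞) + k ≤ Zhang2014.levelIndex W p c.1 →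
          ∃ c', Core k c' ∧ (k : ℕ∞) + mInf ≤ Zhang2014.levelIndex W p c'.1 ∧ m c' ≤ mInf) ∧
        (∀ (k : ℕ) c, 1 ≤ k → Core k c → m c = mInf →
          (k : ℕ∞) + mInf ≤ Zhang2014.levelIndex W p c.1 → t < k → mInf < k → t ≤ mInf))
    (s : ℕ) (hs : s ≤ t) (n : ℕ) (d : KolyvaginHeegnerData Dt β ι n) (hn : Squarefree n)
    (hℓ : ∀ ℓ ∈ n.primeFactors, Zhang2014.IsKolyvaginPrime (W.conductorNorm ℤ) W K p ℓ ∧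
      s ≤ Zhang2014.kolyvaginIndex W p ℓ) :
    ∃ Q : (W.baseChange (ringClassField K ι n)).toAffine.Point,
      ((p ^ s : ℕ) : ℤ) • Q = d.derivedPoint := by
  -- the conductor type and the divisibility predicate
  set Λ := {c : ℕ // Squarefree c ∧ ∀ ℓ ∈ c.primeFactors,
    Zhang2014.IsKolyvaginPrime (W.conductorNorm ℤ) W K p ℓ} with hΛ
  let Dv : ∀ c : ℕ, ℕ → Prop := fun c u ↦ ∀ d : KolyvaginHeegnerData Dt β ι c,
    ∃ Q : (W.baseChange (ringClassField K ι c)).toAffine.Point, ((p ^ u : ℕ) : ℤ) • Q = d.derivedPoint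
  have hDv0 : ∀ c, Dv c 0 := fun c d ↦ ⟨d.derivedPoint, by simp⟩
  have hDvmono : ∀ c {u v : ℕ}, v ≤ u → Dv c u → Dv c v :=
    fun c u v huv h d ↦ exists_pow_smul_eq_of_le p huv (h d)
  -- the depth function `m'(c)` and its characterisation
  let mdivN : ℕ → ℕ∞ := fun c ↦
    if h : ∃ u, ¬ Dv c u then ((Nat.find h - 1 : ℕ) : ℕ∞) else ⊤
  have hchar : ∀ (c u : ℕ), (u : ℕ∞) ≤ mdivN c ↔ Dv c u := by
    intro c u
    by_cases h : ∃ u, ¬ Dv c u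
    · have hfind0 : 0 < Nat.find h := by
        rw [Nat.find_pos]
        exact fun h0 ↦ h0 (hDv0 c)
      simp only [mdivN, dif_pos h, ENat.coe_le_coe]
      constructor
      · intro hu
        have hlt : u < Nat.find h := by omega
        have := (Nat.lt_find_iff h u).mp hlt u le_rfl
        simpa using this
      · intro hu
        have hlt : u < Nat.find h := by
          rw [Nat.lt_find_iff]
          intro v hv hnv
          exact hnv (hDvmono c hv hu)
        omega
    · simp only [mdivN, dif_neg h, le_top, true_iff]
      exact not_not.mp (not_exists.mp h u)
  -- exact-depth witnesses at a finite depth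
  have hexact : ∀ (c u : ℕ), mdivN c = u →
      Dv c u ∧ ∃ d : KolyvaginHeegnerData Dt β ι c,
        (∃ Q : (W.baseChange (ringClassField K ι c)).toAffine.Point,
          ((p ^ u : ℕ) : ℤ) • Q = d.derivedPoint) ∧
        ¬ ∃ Q : (W.baseChange (ringClassField K ι c)).toAffine.Point,
          ((p ^ (u + 1) : ℕ) : ℤ) • Q = d.derivedPoint := by
    intro c u hcu
    have hu : Dv c u := (hchar c u).mp (by rw [hcu])
    have hu1 : ¬ Dv c (u + 1) := by
      rw [← hchar c (u + 1), hcu, ENat.coe_le_coe]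
      omega
    obtain ⟨d, hd⟩ := not_forall.mp hu1
    exact ⟨hu, d, hu d, hd⟩
  -- the functions on `Λ`
  let M : Λ → ℕ∞ := fun c ↦ Zhang2014.levelIndex W p c.1
  let mdiv : Λ → ℕ∞ := fun c ↦ mdivN c.1
  let m : Λ → ℕ∞ := fun c ↦ if mdiv c < M c then mdiv c else ⊤
  have hm : ∀ c, mdiv c < M c → m c ≤ mdiv c := fun c h ↦ by
    simp only [m, if_pos h]
    exact le_rfl
  -- the target conductor as an element of `Λ`, and `s ≤ M(n)`
  let cn : Λ := ⟨n, hn, fun ℓ h ↦ (hℓ ℓ h).1⟩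
  have hsM : (s : ℕ∞) ≤ M cn :=
    Zhang2014.natCast_le_levelIndex_iff.mpr fun ℓ h ↦ (hℓ ℓ h).2
  -- it suffices to bound the depth of conductor `n`
  suffices hgoal : (s : ℕ∞) ≤ mdiv cn from ((hchar n s).mp hgoal) d
  by_contra hlt
  rw [not_le] at hlt
  -- `m'(n)` is finite, `= u₀ < s ≤ M(n)`: McCallum's candidate set is non-empty
  obtain ⟨u₀, hu₀⟩ := ENat.ne_top_iff_exists.mp (ne_top_of_lt hlt)
  -- McCallum's set `⋃_r {u | ∃ c ∈ Λ^r, d : exact depth u, u + 1 ≤ M(ℓ) ∀ ℓ ∣ c}`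
  let T : ℕ → Prop := fun u ↦ ∃ (c : ℕ) (d : KolyvaginHeegnerData Dt β ι c), Squarefree c ∧
      (∀ ℓ ∈ c.primeFactors, Zhang2014.IsKolyvaginPrime (W.conductorNorm ℤ) W K p ℓ ∧
        u + 1 ≤ Zhang2014.kolyvaginIndex W p ℓ) ∧
      (∃ Q : (W.baseChange (ringClassField K ι c)).toAffine.Point,
        ((p ^ u : ℕ) : ℤ) • Q = d.derivedPoint) ∧
      ¬ ∃ Q : (W.baseChange (ringClassField K ι c)).toAffine.Point,
        ((p ^ (u + 1) : ℕ) : ℤ) • Q = d.derivedPoint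
  -- membership of every `c ∈ Λ` with `m'(c) < M(c)`
  have hTmem : ∀ (c : Λ) (u : ℕ), mdiv c = u → mdiv c < M c → T u := by
    intro c u hcu hcM
    obtain ⟨-, d', hd', hnd'⟩ := hexact c.1 u hcu
    have hu1 : ((u + 1 : ℕ) : ℕ∞) ≤ M c := by
      rw [hcu] at hcM
      have : (u : ℕ∞) + 1 ≤ M c := (ENat.add_one_le_iff (ENat.coe_ne_top u)).mpr hcM
      exact_mod_cast this
    exact ⟨c.1, d', c.2.1, fun ℓ h ↦ ⟨c.2.2 ℓ h, (Zhang2014.natCast_le_levelIndex_iff.mp hu1) ℓ h⟩,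
      hd', hnd'⟩
  have hT : ∃ u, T u := ⟨u₀, hTmem cn u₀ hu₀.symm (hlt.trans_le hsM)⟩
  -- `m_∞ := min T`
  set mInf : ℕ := Nat.find hT with hmInfdef
  have hmInfT : T mInf := Nat.find_spec hT
  have hmInfmin : ∀ u, T u → mInf ≤ u := fun u hu ↦ Nat.find_min' hT hu
  -- `hmInf : m_∞ ≤ m(c)`
  have hmInf : ∀ c, (mInf : ℕ∞) ≤ m c := by
    intro c
    by_cases hcM : mdiv c < M c
    · obtain ⟨u, hu⟩ := ENat.ne_top_iff_exists.mp (ne_top_of_lt hcM)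
      have : (mInf : ℕ∞) ≤ mdiv c := by
        rw [← hu, ENat.coe_le_coe]
        exact hmInfmin u (hTmem c u hu.symm hcM)
      simp only [m, if_pos hcM]
      exact this
    · simp only [m, if_neg hcM]
      exact le_top
  -- from an exact-depth-`mInf` datum with `mInf + 1 ≤ M(c)`: `m(c) = m_∞`
  have hmeq : ∀ (c : Λ) (d' : KolyvaginHeegnerData Dt β ι c.1),
      ((mInf + 1 : ℕ) : ℕ∞) ≤ M c →
      (¬ ∃ Q : (W.baseChange (ringClassField K ι c.1)).toAffine.Point,
        ((p ^ (mInf + 1) : ℕ) : ℤ) • Q = d'.derivedPoint) → m c = mInf := by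
    intro c d' hMc hnd'
    -- `m'(c) ≤ mInf`
    have hle : mdiv c ≤ mInf := by
      have h1 : ¬ ((mInf + 1 : ℕ) : ℕ∞) ≤ mdiv c := by
        rw [hchar c.1 (mInf + 1)]
        exact fun h ↦ hnd' (h d')
      rw [not_le] at h1
      have h2 : mdiv c < (mInf : ℕ∞) + 1 := by exact_mod_cast h1
      exact (ENat.lt_add_one_iff (ENat.coe_ne_top mInf)).mp h2
    have hcM : mdiv c < M c := by
      refine lt_of_le_of_lt hle ?_
      have : (mInf : ℕ∞) < (mInf : ℕ∞) + 1 :=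
        ENat.lt_add_one_iff (ENat.coe_ne_top mInf) |>.mpr le_rfl
      exact this.trans_le (by exact_mod_cast hMc)
    have hge : (mInf : ℕ∞) ≤ mdiv c := by
      have := hmInf c
      simp only [m, if_pos hcM] at this
      exact this
    simp only [m, if_pos hcM]
    exact le_antisymm hle hge
  -- `hK : ∀ m', ∃ c, m' ≤ M(c) ∧ m(c) = m_∞` — by `c = 1` (`r = 0`) or McCallum Prop. 5.2 (`r ≥ 1`)
  have hKoly : ∀ m' : ℕ, ∃ c, (m' : ℕ∞) ≤ M c ∧ m c = mInf := by
    intro m'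
    obtain ⟨c₀, d₀, hsq₀, hℓ₀, hd₀, hnd₀⟩ := hmInfT
    by_cases hr : c₀.primeFactors.card = 0
    · -- `r = 0`: `c₀ = 1`, `M(1) = ⊤`
      have hc₀ : c₀ = 1 := by
        rcases Nat.primeFactors_eq_empty.mp (Finset.card_eq_zero.mp hr) with h | h
        · exact absurd h hsq₀.ne_zero
        · exact h
      subst hc₀
      let c1 : Λ := ⟨1, squarefree_one, by simp⟩
      have hM1 : M c1 = ⊤ := Zhang2014.levelIndex_one
      refine ⟨c1, by simp [hM1], hmeq c1 d₀ (by simp [hM1]) hnd₀⟩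
    · -- `r ≥ 1`: McCallum Prop. 5.2 at `M := max m' (m_∞ + 1)`
      have hr0 : 0 < c₀.primeFactors.card := Nat.pos_of_ne_zero hr
      have hleast : IsLeast {u : ℕ | ∃ (c : ℕ) (d : KolyvaginHeegnerData Dt β ι c), Squarefree c ∧
          c.primeFactors.card = c₀.primeFactors.card ∧
          (∀ ℓ ∈ c.primeFactors, Zhang2014.IsKolyvaginPrime (W.conductorNorm ℤ) W K p ℓ ∧
            u + 1 ≤ Zhang2014.kolyvaginIndex W p ℓ) ∧
          (∃ Q : (W.baseChange (ringClassField K ι c)).toAffine.Point,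
            ((p ^ u : ℕ) : ℤ) • Q = d.derivedPoint) ∧
          ¬ ∃ Q : (W.baseChange (ringClassField K ι c)).toAffine.Point,
            ((p ^ (u + 1) : ℕ) : ℤ) • Q = d.derivedPoint} mInf :=
        ⟨⟨c₀, d₀, hsq₀, rfl, hℓ₀, hd₀, hnd₀⟩,
          fun u ⟨c, d', hsq, _, hℓ', hd', hnd'⟩ ↦ hmInfmin u ⟨c, d', hsq, hℓ', hd', hnd'⟩⟩
      obtain ⟨c, d', hsq, -, hℓ', hMc, -, hnd'⟩ :=
        McCallum1991.exists_conductor_levelIndex_ge_exactDepth_of_prop52 h52 W hcm K hK hD3 hD4 hH p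
          hp2 htower Dt β ι d₁ hy _ hr0 mInf hleast (max m' (mInf + 1))
      let cc : Λ := ⟨c, hsq, hℓ'⟩
      have hMc' : ((max m' (mInf + 1) : ℕ) : ℕ∞) ≤ M cc := hMc
      refine ⟨cc, le_trans (by exact_mod_cast le_max_left m' (mInf + 1)) hMc',
        hmeq cc d' (le_trans (by exact_mod_cast le_max_right m' (mInf + 1)) hMc') hnd'⟩
  -- Prop. 6.4 and Thm. 6.3 for these data
  obtain ⟨Core, h64, h63⟩ := H mdiv m (fun c u ↦ hchar c.1 u) (fun c ↦ rfl) mInf hmInf hKoly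
  -- §6 abstract end form (minimal-core-vertex variant)
  have := Section6.depth_le_mdiv_of_le_mInfty M mdiv m hm mInf hmInf
    (Section6.tamagawaExponent_le_mInfty_of_coreVertices_min M m Core t mInf hmInf hKoly h64 h63)
    s hs cn hsM
  exact absurd this (not_le.mpr hlt)


/-- **K3 from McCallum 1991 Prop. 5.2 + the MINIMAL `H`** (Prop. 6.4 at `k ≥ 1`, `m(c) = m_∞`; Thm. 6.3
at `k ≥ 1`), `t := ord_p c_p(E)`. Bookkeeping over `derivedPoint_divisible_of_prop52_of_section6_min`.
[cite: Jetchev2008, Thm. 1.1 (p. 812) and its proof (p. 824)] [cite: McCallumLMS1991, §5 Prop. 5.2 (p. 304)] -/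
theorem jetchevDivisibilityCarrierMult_of_prop52_of_section6_min
    (h52 : McCallum1991.prop52_exists_conductor_kolyvaginClass_order_eq)
    (H : ∀ (W : WeierstrassCurve ℚ) [W.IsElliptic] [W.IsGloballyMinimal] [NeZero (W.conductorNorm ℤ)],
      ¬ W.HasCM → ∀ (K : Type) [Field K] [NumberField K], IsImaginaryQuadratic K →
      NumberField.discr K ≠ -3 → NumberField.discr K ≠ -4 →
      SatisfiesHeegnerHypothesis (W.conductorNorm ℤ) K →
      ∀ (p : ℕ) [Fact p.Prime], p ≠ 2 → W.HasMultiplicativeReductionAtPrime p →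
      (∀ n : ℕ, W.HasSurjectiveModNGaloisRep (p ^ n : ℕ)) →
      ∀ (Dt : ModularParametrizationData W (W.conductorNorm ℤ)) (β : ℤ) (ι : K →+* ℂ)
        (d₁ : KolyvaginHeegnerData Dt β ι 1), ¬ IsOfFinAddOrder d₁.derivedPoint →
      ∀ (mdiv m : {c : ℕ // Squarefree c ∧ ∀ ℓ ∈ c.primeFactors,
          Zhang2014.IsKolyvaginPrime (W.conductorNorm ℤ) W K p ℓ} → ℕ∞),
      (∀ c (u : ℕ), (u : ℕ∞) ≤ mdiv c ↔ ∀ d : KolyvaginHeegnerData Dt β ι c.1,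
        ∃ Q : (W.baseChange (ringClassField K ι c.1)).toAffine.Point,
          ((p ^ u : ℕ) : ℤ) • Q = d.derivedPoint) →
      (∀ c, m c = if mdiv c < Zhang2014.levelIndex W p c.1 then mdiv c else ⊤) →
      ∀ mInf : ℕ, (∀ c, (mInf : ℕ∞) ≤ m c) →
        (∀ m' : ℕ, ∃ c, (m' : ℕ∞) ≤ Zhang2014.levelIndex W p c.1 ∧ m c = mInf) →
      ∃ Core : ℕ → {c : ℕ // Squarefree c ∧ ∀ ℓ ∈ c.primeFactors,
          Zhang2014.IsKolyvaginPrime (W.conductorNorm ℤ) W K p ℓ} → Prop,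
        (∀ (k : ℕ) c, 1 ≤ k → m c = mInf → (mInf : ℕ∞) + k ≤ Zhang2014.levelIndex W p c.1 →
          ∃ c', Core k c' ∧ (k : ℕ∞) + mInf ≤ Zhang2014.levelIndex W p c'.1 ∧ m c' ≤ mInf) ∧
        (∀ (k : ℕ) c, 1 ≤ k → Core k c → m c = mInf →
          (k : ℕ∞) + mInf ≤ Zhang2014.levelIndex W p c.1 →
          padicValNat p ((W.baseChange ℚ_[p]).localTamagawaNumber ℤ_[p]) < k → mInf < k →
          padicValNat p ((W.baseChange ℚ_[p]).localTamagawaNumber ℤ_[p]) ≤ mInf)) :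
    JetchevDivisibilityCarrierMult := by
  intro W _ _ _ hcm K _ _ hK hD3 hD4 hH p _ hp2 hmult htower Dt β ι d₁ hy s hs n d hn hℓ
  exact derivedPoint_divisible_of_prop52_of_section6_min h52 W hcm K hK hD3 hD4 hH p hp2 htower Dt β ι
    d₁ hy _ (H W hcm K hK hD3 hD4 hH p hp2 hmult htower Dt β ι d₁ hy) s hs n d hn hℓ

/-- **K1 from McCallum 1991 Prop. 5.2 + the MINIMAL `H`**, `t := ord_p c_q(E)` at a carrier `q ∣ N`,
`q ≠ p`. Bookkeeping. [cite: Jetchev2008, Thm. 1.1 (p. 812) and its proof (p. 824)] [cite: McCallumLMS1991, §5 Prop. 5.2 (p. 304)] -/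
theorem jetchevDivisibilityCarrierNe_of_prop52_of_section6_min
    (h52 : McCallum1991.prop52_exists_conductor_kolyvaginClass_order_eq)
    (H : ∀ (W : WeierstrassCurve ℚ) [W.IsElliptic] [W.IsGloballyMinimal] [NeZero (W.conductorNorm ℤ)],
      ¬ W.HasCM → ∀ (K : Type) [Field K] [NumberField K], IsImaginaryQuadratic K →
      NumberField.discr K ≠ -3 → NumberField.discr K ≠ -4 →
      SatisfiesHeegnerHypothesis (W.conductorNorm ℤ) K →
      ∀ (p : ℕ) [Fact p.Prime], p ≠ 2 → (∀ n : ℕ, W.HasSurjectiveModNGaloisRep (p ^ n : ℕ)) →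
      ∀ (Dt : ModularParametrizationData W (W.conductorNorm ℤ)) (β : ℤ) (ι : K →+* ℂ)
        (d₁ : KolyvaginHeegnerData Dt β ι 1), ¬ IsOfFinAddOrder d₁.derivedPoint →
      ∀ (q : ℕ) [Fact q.Prime], q ∣ W.conductorNorm ℤ → q ≠ p →
      ∀ (mdiv m : {c : ℕ // Squarefree c ∧ ∀ ℓ ∈ c.primeFactors,
          Zhang2014.IsKolyvaginPrime (W.conductorNorm ℤ) W K p ℓ} → ℕ∞),
      (∀ c (u : ℕ), (u : ℕ∞) ≤ mdiv c ↔ ∀ d : KolyvaginHeegnerData Dt β ι c.1,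
        ∃ Q : (W.baseChange (ringClassField K ι c.1)).toAffine.Point,
          ((p ^ u : ℕ) : ℤ) • Q = d.derivedPoint) →
      (∀ c, m c = if mdiv c < Zhang2014.levelIndex W p c.1 then mdiv c else ⊤) →
      ∀ mInf : ℕ, (∀ c, (mInf : ℕ∞) ≤ m c) →
        (∀ m' : ℕ, ∃ c, (m' : ℕ∞) ≤ Zhang2014.levelIndex W p c.1 ∧ m c = mInf) →
      ∃ Core : ℕ → {c : ℕ // Squarefree c ∧ ∀ ℓ ∈ c.primeFactors,
          Zhang2014.IsKolyvaginPrime (W.conductorNorm ℤ) W K p ℓ} → Prop,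
        (∀ (k : ℕ) c, 1 ≤ k → m c = mInf → (mInf : ℕ∞) + k ≤ Zhang2014.levelIndex W p c.1 →
          ∃ c', Core k c' ∧ (k : ℕ∞) + mInf ≤ Zhang2014.levelIndex W p c'.1 ∧ m c' ≤ mInf) ∧
        (∀ (k : ℕ) c, 1 ≤ k → Core k c → m c = mInf →
          (k : ℕ∞) + mInf ≤ Zhang2014.levelIndex W p c.1 →
          padicValNat p ((W.baseChange ℚ_[q]).localTamagawaNumber ℤ_[q]) < k → mInf < k →
          padicValNat p ((W.baseChange ℚ_[q]).localTamagawaNumber ℤ_[q]) ≤ mInf)) :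
    JetchevDivisibilityCarrierNe := by
  intro W _ _ _ hcm K _ _ hK hD3 hD4 hH p _ hp2 htower Dt β ι d₁ hy q _ hqN hqp s hs n d hn hℓ
  exact derivedPoint_divisible_of_prop52_of_section6_min h52 W hcm K hK hD3 hD4 hH p hp2 htower Dt β ι
    d₁ hy _ (H W hcm K hK hD3 hD4 hH p hp2 htower Dt β ι d₁ hy q hqN hqp) s hs n d hn hℓ

/-- **K4 from McCallum 1991 Prop. 5.2 + the MINIMAL `H`**, `t := ord_p c_p(E)`, `E` additive at
`p`. Bookkeeping. [cite: Jetchev2008, Thm. 1.1 (p. 812) and its proof (p. 824)] [cite: McCallumLMS1991, §5 Prop. 5.2 (p. 304)] -/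
theorem jetchevDivisibilityCarrierAdd_of_prop52_of_section6_min
    (h52 : McCallum1991.prop52_exists_conductor_kolyvaginClass_order_eq)
    (H : ∀ (W : WeierstrassCurve ℚ) [W.IsElliptic] [W.IsGloballyMinimal] [NeZero (W.conductorNorm ℤ)],
      ¬ W.HasCM → ∀ (K : Type) [Field K] [NumberField K], IsImaginaryQuadratic K →
      NumberField.discr K ≠ -3 → NumberField.discr K ≠ -4 →
      SatisfiesHeegnerHypothesis (W.conductorNorm ℤ) K →
      ∀ (p : ℕ) [Fact p.Prime], p ≠ 2 →
      ¬ W.HasGoodReductionAtPrime p → ¬ W.HasMultiplicativeReductionAtPrime p →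
      (∀ n : ℕ, W.HasSurjectiveModNGaloisRep (p ^ n : ℕ)) →
      ∀ (Dt : ModularParametrizationData W (W.conductorNorm ℤ)) (β : ℤ) (ι : K →+* ℂ)
        (d₁ : KolyvaginHeegnerData Dt β ι 1), ¬ IsOfFinAddOrder d₁.derivedPoint →
      ∀ (mdiv m : {c : ℕ // Squarefree c ∧ ∀ ℓ ∈ c.primeFactors,
          Zhang2014.IsKolyvaginPrime (W.conductorNorm ℤ) W K p ℓ} → ℕ∞),
      (∀ c (u : ℕ), (u : ℕ∞) ≤ mdiv c ↔ ∀ d : KolyvaginHeegnerData Dt β ι c.1,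
        ∃ Q : (W.baseChange (ringClassField K ι c.1)).toAffine.Point,
          ((p ^ u : ℕ) : ℤ) • Q = d.derivedPoint) →
      (∀ c, m c = if mdiv c < Zhang2014.levelIndex W p c.1 then mdiv c else ⊤) →
      ∀ mInf : ℕ, (∀ c, (mInf : ℕ∞) ≤ m c) →
        (∀ m' : ℕ, ∃ c, (m' : ℕ∞) ≤ Zhang2014.levelIndex W p c.1 ∧ m c = mInf) →
      ∃ Core : ℕ → {c : ℕ // Squarefree c ∧ ∀ ℓ ∈ c.primeFactors,
          Zhang2014.IsKolyvaginPrime (W.conductorNorm ℤ) W K p ℓ} → Prop,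
        (∀ (k : ℕ) c, 1 ≤ k → m c = mInf → (mInf : ℕ∞) + k ≤ Zhang2014.levelIndex W p c.1 →
          ∃ c', Core k c' ∧ (k : ℕ∞) + mInf ≤ Zhang2014.levelIndex W p c'.1 ∧ m c' ≤ mInf) ∧
        (∀ (k : ℕ) c, 1 ≤ k → Core k c → m c = mInf →
          (k : ℕ∞) + mInf ≤ Zhang2014.levelIndex W p c.1 →
          padicValNat p ((W.baseChange ℚ_[p]).localTamagawaNumber ℤ_[p]) < k → mInf < k →
          padicValNat p ((W.baseChange ℚ_[p]).localTamagawaNumber ℤ_[p]) ≤ mInf)) :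
    JetchevDivisibilityCarrierAdd := by
  intro W _ _ _ hcm K _ _ hK hD3 hD4 hH p _ hp2 hgood hmult htower Dt β ι d₁ hy s hs n d hn hℓ
  exact derivedPoint_divisible_of_prop52_of_section6_min h52 W hcm K hK hD3 hD4 hH p hp2 htower Dt β ι
    d₁ hy _ (H W hcm K hK hD3 hD4 hH p hp2 hgood hmult htower Dt β ι d₁ hy) s hs n d hn hℓ

end Summit.BirchSwinnertonDyer.Rank1Residual.JET

end
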